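import Literature.NumberTheory.LFunctions.InvZetaMellinBarnes
import Literature.NumberTheory.LFunctions.RHZetaRatioBound
import Literature.Analysis.Complex.VerticalLineShiftPoles
import HarnessLib

/-!
# Balazard–de Roton 2010, Proposition 5: the exact value of `L_ε` by the residue theorem

Topic `Literature/NumberTheory/LFunctions`; a brick of the proof of Balazard–de Roton 2010,
Théorème 1 (`Literature.NumberTheory.LFunctions.BalazardDeRoton2010_thm1`, `NymanBeurlingRate.lean`).
M. Balazard, A. de Roton, *Sur un critère de Báez-Duarte pour l'hypothèse de Riemann*, Int. J.
Number Theory 6 (2010) 883–903 = arXiv:0812.1689, §4: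

> **Proposition 5 (HR).** `L_ε := (1/2π) ∫_{σ=1/2} ζ(s)/ζ(s+ε) dτ/|s|²`
> ` = (γ−1)/ζ(1+ε) − ζ'(1+ε)/ζ²(1+ε) = 1 − (γ+1)ε + O(ε²)`.

Printed proof: `L_ε = (1/2πi)∫_{σ=1/2} Q(s) ds` with `Q(s) = (ζ(s)/ζ(s+ε))/(s(1−s))`, meromorphic
on `σ ≥ 1/2` with a single (double) pole at `s = 1`, `sQ(s) → 0` and `∫|Q| < ∞` on the line
(Prop. 4 (iii)), so by the half-plane residue theorem (Whittaker–Watson 6.22)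
`L_ε = −Res_{s=1} Q`. Here (`0 < ε ≤ 1/4`, under RH):

* `BalazardDeRoton.qFun ε` is `Q`, written with the tree's pole-free `zetaInv = 1/ζ`
  (`MertensBoundRH.zetaInv`), and `BalazardDeRoton.qNum ε z = −ζ₁(z) zetaInv(z+ε)/z` its regular
  numerator at the double pole, `Q(z) = qNum(z)/(z−1)²` (`ζ₁ = (s−1)ζ`, Mathlib `riemannZeta₁`);
* the line `σ = 1/2` is moved to `σ = 2` across the pole with the tree's residue theorem for
  vertical lines (`Literature.Analysis.Complex.integral_vertical_sub_eq_sum_of_poles`; decay in the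
  strip from `ζ(s) = O(|t|)`, `1/ζ(s+ε) = O(|t|^{1/2})` under RH; integrability on `σ = 1/2` from
  `ZetaRatioRH.norm_riemannZeta_half_le_of_RH`), and `∫_{σ=2} Q = 0` by moving further to
  `σ = X → ∞` (`MertensBoundRH.integral_vertical_eq_of_tendsto`);
* `integral_qFun_half`: **`∫ Q(½+iτ) dτ = 2π ((γ−1)·zetaInv(1+ε) + zetaInv'(1+ε))`**, i.e.
  `L_ε = (γ−1)/ζ(1+ε) − ζ'(1+ε)/ζ(1+ε)²` (`−Res_{s=1}Q = −qNum'(1)`, `ζ₁(1) = 1`, `ζ₁'(1) = γ`);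
* `norm_lValue_sub_one_le`: `|(γ−1)/ζ(1+ε) − ζ'(1+ε)/ζ(1+ε)² − 1| ≤ Cε` for `0 < ε ≤ ε₀`
  (the printed `1 − (γ+1)ε + O(ε²)` to first order, which is all Proposition 2 uses).

## References

* [BalazardDeRoton2010] M. Balazard, A. de Roton, Int. J. Number Theory 6 (2010) 883–903, §4,
  Prop. 5 (arXiv:0812.1689 p. 5).
* [WhittakerWatson1927] E. T. Whittaker, G. N. Watson, *A Course of Modern Analysis*, 4th ed.,
  §6.22.
-/

noncomputable section

open Complex Filter Topology Set MeasureTheory Real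

namespace Literature.NumberTheory.LFunctions

namespace BalazardDeRoton

open MertensBoundRH (zetaInv zetaInv_of_ne_one differentiableOn_zetaInv continuousOn_zetaInv
  norm_zetaInv_le_of_two_le differentiableAt_zetaInv_of_ne_one)

/-! ## The integrand `Q` and its regular numerator at `s = 1` -/

/-- Balazard–de Roton's `Q(s) = (ζ(s)/ζ(s+ε))/(s(1−s))` (§4, proof of Prop. 5), with `1/ζ`
written as the tree's pole-free `zetaInv` (equal to `ζ⁻¹` off `1`, and to `0 = 1/ζ(1)` at `1`).
[cite: BalazardDeRoton2010, §4 (proof of Prop. 5)] -/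
def qFun (ε : ℝ) (z : ℂ) : ℂ := riemannZeta z * zetaInv (z + ε) / (z * (1 - z))

/-- The regular numerator of `Q` at its double pole `s = 1`:
`qNum(z) = −ζ₁(z) zetaInv(z+ε)/z`, so that `Q(z) = qNum(z)/(z−1)²` (`ζ₁(z) = (z−1)ζ(z)`).
[cite: BalazardDeRoton2010, §4 (proof of Prop. 5)] -/
def qNum (ε : ℝ) (z : ℂ) : ℂ := -(riemannZeta₁ z * zetaInv (z + ε)) / z

/-- `Q = qNum/(z−1)²` off `z = 1`. [folklore] -/
lemma qFun_eq_qNum_div {ε : ℝ} {z : ℂ} (hz : z ≠ 1) :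
    qFun ε z = qNum ε z / (z - 1) ^ 2 := by
  have h1 : z - 1 ≠ 0 := sub_ne_zero.mpr hz
  have h2 : 1 - z ≠ 0 := sub_ne_zero.mpr (Ne.symm hz)
  rw [qFun, qNum, riemannZeta_eq_inv_sub_mul hz]
  by_cases hz0 : z = 0
  · subst hz0; simp
  field_simp
  ring

/-- On the critical line `s = ½ + iτ`: `s(1−s) = |s|²`, so `Q(s) = ζ(s) zetaInv(s+ε)/|s|²`.
[cite: BalazardDeRoton2010, §4 (proof of Prop. 5, first display)] -/
lemma qFun_half (ε τ : ℝ) :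
    qFun ε (1 / 2 + τ * I) =
      riemannZeta (1 / 2 + τ * I) * zetaInv (1 / 2 + τ * I + ε) /
        ((‖(1 / 2 + τ * I : ℂ)‖ ^ 2 : ℝ) : ℂ) := by
  rw [qFun]
  congr 1
  rw [Complex.sq_norm, Complex.normSq_apply]
  apply Complex.ext <;> simp <;> ring

/-! ## Holomorphy -/

/-- Under RH, `z ↦ zetaInv(z+ε)` is holomorphic on `Re z > 1/2 − ε`. [folklore] -/
lemma differentiableOn_zetaInv_shift (hRH : RiemannHypothesis) (ε : ℝ) :
    DifferentiableOn ℂ (fun z ↦ zetaInv (z + ε)) {z : ℂ | 1 / 2 - ε < z.re} := by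
  intro z hz
  have hz' : 1 / 2 < (z + ε).re := by simp; linarith [show 1 / 2 - ε < z.re from hz]
  have h1 : DifferentiableAt ℂ zetaInv (z + ε) :=
    ((differentiableOn_zetaInv hRH) _ hz').differentiableAt ((isOpen_lt continuous_const Complex.continuous_re).mem_nhds hz')
  exact (h1.comp z (differentiableAt_id.add_const _)).differentiableWithinAt

/-- Under RH and for `0 < ε < 1/2`, `Q` is holomorphic on `{Re z > 1/2 − ε} ∖ {1}`. [folklore] -/
lemma differentiableOn_qFun (hRH : RiemannHypothesis) {ε : ℝ} (hε2 : ε < 1 / 2) :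
    DifferentiableOn ℂ (qFun ε) ({z : ℂ | 1 / 2 - ε < z.re} \ {1}) := by
  intro z hz
  obtain ⟨hz, hz1⟩ := hz
  have hz1 : z ≠ 1 := hz1
  have hzre : 1 / 2 - ε < z.re := hz
  have hz0 : z ≠ 0 := fun h ↦ by rw [h, zero_re] at hzre; linarith
  have hden : z * (1 - z) ≠ 0 := mul_ne_zero hz0 (sub_ne_zero.mpr (Ne.symm hz1))
  refine DifferentiableAt.differentiableWithinAt ?_
  unfold qFun
  refine DifferentiableAt.div (DifferentiableAt.mul (differentiableAt_riemannZeta hz1) ?_)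
    (by fun_prop) hden
  exact (differentiableOn_zetaInv_shift hRH ε _ hz).differentiableAt
    ((isOpen_lt continuous_const Complex.continuous_re).mem_nhds hz)

/-- Under RH, `qNum` is holomorphic on `Re z > 1/2 − ε` (`0 < ε < 1/2`). [folklore] -/
lemma differentiableOn_qNum (hRH : RiemannHypothesis) {ε : ℝ} (hε2 : ε < 1 / 2) :
    DifferentiableOn ℂ (qNum ε) {z : ℂ | 1 / 2 - ε < z.re} := by
  intro z hz
  have hzre : 1 / 2 - ε < z.re := hz
  have hz0 : z ≠ 0 := fun h ↦ by rw [h, zero_re] at hzre; linarith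
  unfold qNum
  refine DifferentiableAt.differentiableWithinAt (DifferentiableAt.div ?_ differentiableAt_id hz0)
  exact ((differentiable_riemannZeta₁ z).mul ((differentiableOn_zetaInv_shift hRH ε _ hz
    ).differentiableAt ((isOpen_lt continuous_const Complex.continuous_re).mem_nhds hz))).neg

/-- **The residue.** `qNum'(1) = −(γ·zetaInv(1+ε) + zetaInv'(1+ε) − zetaInv(1+ε))`
(`ζ₁(1) = 1`, `ζ₁'(1) = γ`), i.e. `Res_{s=1} Q = −((γ−1)/ζ(1+ε) − ζ'(1+ε)/ζ(1+ε)²)`.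
[cite: BalazardDeRoton2010, Prop. 5 (the residue at s = 1)] -/
lemma hasDerivAt_qNum_one (hRH : RiemannHypothesis) {ε : ℝ} (hε : 0 < ε) :
    HasDerivAt (qNum ε) (-((eulerMascheroniConstant - 1) * zetaInv (1 + ε) +
      deriv zetaInv (1 + ε))) 1 := by
  -- the three factors
  have hA : HasDerivAt riemannZeta₁ (eulerMascheroniConstant : ℂ) 1 := by
    rw [← deriv_riemannZeta₁_one]; exact (differentiable_riemannZeta₁ 1).hasDerivAt
  have h1ε : (1 : ℂ) + ε ≠ 1 := by
    intro h; have := congrArg Complex.re h; simp at this; exact hε.ne' this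
  have hB0 : DifferentiableAt ℂ zetaInv (1 + ε) :=
    differentiableAt_zetaInv_of_ne_one hRH (by simp; linarith) h1ε
  have hB : HasDerivAt (fun z : ℂ ↦ zetaInv (z + ε)) (deriv zetaInv (1 + ε)) 1 :=
    hB0.hasDerivAt.comp_add_const (1 : ℂ) (ε : ℂ)
  have hC : HasDerivAt (fun z : ℂ ↦ z) 1 1 := hasDerivAt_id 1
  have h := ((hA.mul hB).neg).div hC one_ne_zero
  simp only [Pi.neg_apply, Pi.mul_apply, riemannZeta₁_one, one_mul, mul_one, one_pow,
    div_one] at h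
  refine h.congr_deriv ?_
  ring

/-- `qNum'(1)` as a `deriv`. [folklore] -/
lemma deriv_qNum_one (hRH : RiemannHypothesis) {ε : ℝ} (hε : 0 < ε) :
    deriv (qNum ε) 1 = -((eulerMascheroniConstant - 1) * zetaInv (1 + ε) +
      deriv zetaInv (1 + ε)) :=
  (hasDerivAt_qNum_one hRH hε).deriv

/-! ## Bounds for `Q` -/

/-- **Decay in the strip** (the rôle of Prop. 4 (iii)): under RH, for `0 < ε ≤ 1/4` there is `K`
with `‖Q(u+iT)‖ ≤ K |T|^{-1/2}` for `1/2 ≤ u ≤ 2`, `|T| ≥ 2` (`ζ = O(|T|)`,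
`zetaInv = O(|T|^{1/2})` on `Re ≥ 1/2 + ε`, denominator `≥ T²`).
[cite: BalazardDeRoton2010, Prop. 4 (iii) and §4] -/
lemma exists_norm_qFun_strip_le (hRH : RiemannHypothesis) {ε : ℝ} (hε : 0 < ε) :
    ∃ K : ℝ, 0 < K ∧ ∀ u T : ℝ, 1 / 2 ≤ u → u ≤ 2 → 2 ≤ |T| →
      ‖qFun ε (u + T * I)‖ ≤ K * |T| ^ (-(1 / 2 : ℝ)) := by
  obtain ⟨K, hK0, hK⟩ := MellinBarnes.exists_norm_zetaInv_le hRH (σ₀ := 1 / 2 + ε) (by linarith)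
    (δ := 1 / 2) one_half_pos
  refine ⟨10 * K, by positivity, fun u T hu hu2 hT ↦ ?_⟩
  set s : ℂ := u + T * I with hs
  have hsre : s.re = u := by simp [hs]
  have hsim : s.im = T := by simp [hs]
  have hT0 : 0 < |T| := by linarith
  have hs1 : s ≠ 1 := fun h ↦ by
    have := congrArg Complex.im h; rw [hsim] at this; simp at this; rw [this] at hT; simp at hT
    linarith
  -- `‖s‖ ≤ 2|T|`, `‖s − 1‖ ≥ |T|`, `‖1 − s‖ ≥ |T|`, `‖s‖ ≥ |T|`
  have hn1 : ‖s‖ ≤ 2 * |T| := by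
    calc ‖s‖ ≤ |s.re| + |s.im| := norm_le_abs_re_add_abs_im s
      _ = |u| + |T| := by rw [hsre, hsim]
      _ ≤ 2 * |T| := by rw [abs_of_pos (by linarith)]; linarith
  have hn2 : |T| ≤ ‖s - 1‖ := by simpa [hsim] using abs_im_le_norm (s - 1)
  have hn3 : |T| ≤ ‖1 - s‖ := by rw [← norm_neg, neg_sub]; exact hn2
  have hn4 : |T| ≤ ‖s‖ := by simpa [hsim] using abs_im_le_norm s
  -- `ζ`
  have hζ : ‖riemannZeta s‖ ≤ 5 * |T| := by
    have h := Literature.NumberTheory.LFunctions.norm_riemannZeta_le_of_re_pos (s := s)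
      (by rw [hsre]; linarith) hs1
    have e1 : ‖s‖ / ‖s - 1‖ ≤ 2 := by
      rw [div_le_iff₀ (by linarith)]; linarith
    have e2 : ‖s‖ / s.re ≤ 4 * |T| := by
      rw [hsre, div_le_iff₀ (by linarith)]; nlinarith
    linarith
  -- `zetaInv`
  have hζi : ‖zetaInv (s + ε)‖ ≤ K * (2 * |T| ^ (1 / 2 : ℝ)) := by
    have h := hK (s + ε) (by simp [hs]; linarith)
    have him : (s + ε).im = T := by simp [hs]
    rw [him] at h
    refine h.trans (mul_le_mul_of_nonneg_left ?_ hK0.le)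
    calc (1 + |T|) ^ (1 / 2 : ℝ) ≤ (4 * |T|) ^ (1 / 2 : ℝ) :=
          Real.rpow_le_rpow (by positivity) (by linarith) (by norm_num)
      _ = 2 * |T| ^ (1 / 2 : ℝ) := by
          rw [Real.mul_rpow (by norm_num) hT0.le, show (4 : ℝ) = 2 ^ 2 by norm_num,
            ← Real.rpow_natCast, ← Real.rpow_mul (by norm_num)]
          norm_num
  -- denominator
  have hden : |T| * |T| ≤ ‖s * (1 - s)‖ := by
    rw [norm_mul]; exact mul_le_mul hn4 hn3 hT0.le (norm_nonneg _)
  have hden0 : 0 < ‖s * (1 - s)‖ := lt_of_lt_of_le (by positivity) hden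
  rw [qFun, norm_div, norm_mul, div_le_iff₀ hden0]
  have hpow : |T| = |T| ^ (1 / 2 : ℝ) * |T| ^ (1 / 2 : ℝ) := by
    rw [← Real.rpow_add hT0]; norm_num
  have hh : 0 < |T| ^ (1 / 2 : ℝ) := Real.rpow_pos_of_pos hT0 _
  have hpow' : |T| ^ (-(1 / 2 : ℝ)) * (|T| * |T|) = |T| ^ (1 / 2 : ℝ) * |T| := by
    rw [Real.rpow_neg hT0.le, inv_mul_eq_iff_eq_mul₀ hh.ne', ← mul_assoc, ← hpow]
  calc ‖riemannZeta s‖ * ‖zetaInv (s + ε)‖ ≤ (5 * |T|) * (K * (2 * |T| ^ (1 / 2 : ℝ))) :=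
        mul_le_mul hζ hζi (norm_nonneg _) (by positivity)
    _ = 10 * K * (|T| ^ (1 / 2 : ℝ) * |T|) := by ring
    _ = 10 * K * |T| ^ (-(1 / 2 : ℝ)) * (|T| * |T|) := by rw [← hpow']; ring
    _ ≤ 10 * K * |T| ^ (-(1 / 2 : ℝ)) * ‖s * (1 - s)‖ := by gcongr

/-- The constant `B₀ = ∑ (n+1)^{-2}` bounding `zetaInv` on `Re ≥ 2`. [folklore] -/
lemma tsum_inv_sq_nonneg : 0 ≤ ∑' n : ℕ, 1 / ((n : ℝ) + 1) ^ 2 :=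
  tsum_nonneg fun n ↦ by positivity

/-- **Bound far to the right**: for `Re s = X ≥ 2`, `‖Q(X+it)‖ ≤ 2B₀/((X−1)² + t²)`
(`|ζ| ≤ 2`, `|zetaInv| ≤ B₀`, `|s(1−s)| ≥ (X−1)² + t²`). [folklore] -/
lemma norm_qFun_right_le {ε : ℝ} (hε : 0 ≤ ε) {X : ℝ} (hX : 2 ≤ X) (t : ℝ) :
    ‖qFun ε (X + t * I)‖ ≤ 2 * (∑' n : ℕ, 1 / ((n : ℝ) + 1) ^ 2) / ((X - 1) ^ 2 + t ^ 2) := by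
  set B₀ : ℝ := ∑' n : ℕ, 1 / ((n : ℝ) + 1) ^ 2 with hB₀
  set s : ℂ := X + t * I with hs
  have hsre : s.re = X := by simp [hs]
  have hζ : ‖riemannZeta s‖ ≤ 2 := by
    have h := InvZetaRH.norm_riemannZeta_sub_one_le (s := s) (by rw [hsre]; exact hX)
    have := InvZetaRH.rho_lt_one
    calc ‖riemannZeta s‖ ≤ ‖riemannZeta s - 1‖ + ‖(1 : ℂ)‖ := norm_le_norm_sub_add _ _
      _ ≤ 2 := by rw [norm_one]; linarith
  have hζi : ‖zetaInv (s + ε)‖ ≤ B₀ := norm_zetaInv_le_of_two_le (by simp [hs]; linarith)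
  have hd : (X - 1) ^ 2 + t ^ 2 ≤ ‖s * (1 - s)‖ := by
    have e1 : ‖1 - s‖ ^ 2 = (X - 1) ^ 2 + t ^ 2 := by
      rw [Complex.sq_norm, Complex.normSq_apply]; simp [hs]; ring
    have e2 : (X - 1) ^ 2 + t ^ 2 ≤ ‖s‖ ^ 2 := by
      rw [Complex.sq_norm, Complex.normSq_apply]; simp [hs]; nlinarith
    have h0 : 0 ≤ (X - 1) ^ 2 + t ^ 2 := by positivity
    have h1 : ‖1 - s‖ = Real.sqrt ((X - 1) ^ 2 + t ^ 2) := by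
      rw [← e1, Real.sqrt_sq (norm_nonneg _)]
    have h2 : Real.sqrt ((X - 1) ^ 2 + t ^ 2) ≤ ‖s‖ := by
      rw [← Real.sqrt_sq (norm_nonneg s)]; exact Real.sqrt_le_sqrt e2
    rw [norm_mul, h1]
    calc (X - 1) ^ 2 + t ^ 2 = Real.sqrt ((X - 1) ^ 2 + t ^ 2) * Real.sqrt ((X - 1) ^ 2 + t ^ 2) :=
          (Real.mul_self_sqrt h0).symm
      _ ≤ ‖s‖ * Real.sqrt ((X - 1) ^ 2 + t ^ 2) :=
          mul_le_mul_of_nonneg_right h2 (Real.sqrt_nonneg _)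
  have hd0 : 0 < (X - 1) ^ 2 + t ^ 2 := by nlinarith
  rw [qFun, norm_div, norm_mul, div_le_div_iff₀ (hd0.trans_le hd) hd0]
  calc ‖riemannZeta s‖ * ‖zetaInv (s + ε)‖ * ((X - 1) ^ 2 + t ^ 2)
      ≤ 2 * B₀ * ((X - 1) ^ 2 + t ^ 2) := by gcongr
    _ ≤ 2 * B₀ * ‖s * (1 - s)‖ := by
        have : 0 ≤ 2 * B₀ := by have := tsum_inv_sq_nonneg; positivity
        gcongr

/-- Continuity of `t ↦ Q(σ + it)` for `σ ≥ 1/2` under RH (`0 < ε < 1/2`; the pole `s = 1` is not on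
these lines for `σ ≠ 1`, and for `σ = 1` only at `t = 0`… we only need `σ ∈ {1/2} ∪ [2, ∞)`).
[folklore] -/
lemma continuous_qFun_line (hRH : RiemannHypothesis) {ε : ℝ} (hε : 0 < ε) (hε2 : ε < 1 / 2)
    {σ : ℝ} (hσ : 1 / 2 ≤ σ) (hσ1 : σ ≠ 1) : Continuous fun t : ℝ ↦ qFun ε (σ + t * I) := by
  refine (differentiableOn_qFun hRH hε2).continuousOn.comp_continuous (by fun_prop) fun t ↦ ?_
  refine ⟨?_, ?_⟩
  · show 1 / 2 - ε < ((σ : ℂ) + t * I).re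
    simp; linarith
  · intro h
    have := congrArg Complex.re h
    simp at this
    exact hσ1 this

/-- Integrability of `Q` on the lines `Re s = X ≥ 2`. [folklore] -/
lemma integrable_qFun_right (hRH : RiemannHypothesis) {ε : ℝ} (hε : 0 < ε) (hε2 : ε < 1 / 2)
    {X : ℝ} (hX : 2 ≤ X) : Integrable fun t : ℝ ↦ qFun ε (X + t * I) := by
  set B₀ : ℝ := ∑' n : ℕ, 1 / ((n : ℝ) + 1) ^ 2 with hB₀
  refine Integrable.mono' ((integrable_inv_one_add_sq).const_mul (2 * B₀))
    (continuous_qFun_line hRH hε hε2 (by linarith) (by linarith)).aestronglyMeasurable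
    (ae_of_all _ fun t ↦ ?_)
  refine (norm_qFun_right_le hε.le hX t).trans ?_
  rw [← div_eq_mul_inv]
  refine div_le_div_of_nonneg_left (by have := tsum_inv_sq_nonneg; positivity) (by positivity) ?_
  nlinarith

/-- Integrability of `Q` on the critical line under RH (`0 < ε ≤ 1/4`):
`|Q(½+iτ)| ≤ C(1+|τ|)^{ε/2}/|s|² ≪ (1+|τ|)^{-3/2}` by `|ζ(s)| ≤ C(1+|τ|)^{ε/2}|ζ(s+ε)|`
(`ZetaRatioRH.norm_riemannZeta_half_le_of_RH`). [cite: BalazardDeRoton2010, §4 ("∫_Δ |Q| < ∞")] -/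
lemma integrable_qFun_half (hRH : RiemannHypothesis) {ε : ℝ} (hε : 0 < ε) (hε1 : ε ≤ 1 / 4) :
    Integrable fun τ : ℝ ↦ qFun ε (((1 / 2 : ℝ) : ℂ) + τ * I) := by
  obtain ⟨C, hC, hCb⟩ := ZetaRatioRH.norm_riemannZeta_half_le_of_RH hRH
  have hint : Integrable fun τ : ℝ ↦ 8 * C * (1 + ‖τ‖) ^ (-(3 / 2 : ℝ)) :=
    (integrable_one_add_norm (by simp; norm_num)).const_mul _
  refine hint.mono' ?_ (ae_of_all _ fun τ ↦ ?_)
  · have := (continuous_qFun_line hRH hε (by linarith) (σ := 1 / 2) le_rfl (by norm_num))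
    exact this.aestronglyMeasurable
  have e : (((1 / 2 : ℝ) : ℂ) + τ * I) = 1 / 2 + τ * I := by push_cast; ring
  rw [e, qFun_half, norm_div, Complex.norm_real, Real.norm_eq_abs, abs_of_nonneg (sq_nonneg _),
    norm_mul, Real.norm_eq_abs]
  set s : ℂ := 1 / 2 + τ * I with hs
  have hsε : s + ε = 1 / 2 + ε + τ * I := by rw [hs]; ring
  -- `‖ζ s‖ ‖zetaInv (s+ε)‖ ≤ C (1+|τ|)^{ε/2}`
  have hs1 : s + ε ≠ 1 := fun h ↦ by
    have := congrArg Complex.re h; simp [hs] at this; linarith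
  have hnum : ‖riemannZeta s‖ * ‖zetaInv (s + ε)‖ ≤ C * (1 + |τ|) ^ (ε / 2) := by
    rw [zetaInv_of_ne_one hs1, hsε, norm_inv]
    have h := hCb ε hε (by linarith) τ
    by_cases hz : riemannZeta (1 / 2 + ε + τ * I) = 0
    · rw [hz, norm_zero, inv_zero, mul_zero]; positivity
    · have h0 : 0 < ‖riemannZeta (1 / 2 + ε + τ * I)‖ := norm_pos_iff.mpr hz
      rw [← le_div_iff₀ (inv_pos.mpr h0), div_inv_eq_mul]
      exact h
  -- `‖s‖² ≥ (1+|τ|)²/8`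
  have hsq : ‖s‖ ^ 2 = 1 / 4 + τ ^ 2 := by
    rw [Complex.sq_norm, Complex.normSq_apply]; simp [hs]; ring
  have hden : (1 + |τ|) ^ 2 / 8 ≤ ‖s‖ ^ 2 := by
    rw [hsq]; have := sq_abs τ; nlinarith [abs_nonneg τ]
  have hT : 0 < 1 + |τ| := by positivity
  rw [div_le_iff₀ (by rw [hsq]; positivity)]
  calc ‖riemannZeta s‖ * ‖zetaInv (s + ε)‖ ≤ C * (1 + |τ|) ^ (ε / 2) := hnum
    _ ≤ C * (1 + |τ|) ^ (1 / 2 : ℝ) :=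
        mul_le_mul_of_nonneg_left (Real.rpow_le_rpow_of_exponent_le
          (by linarith [abs_nonneg τ]) (by linarith)) hC.le
    _ = 8 * C * (1 + |τ|) ^ (-(3 / 2 : ℝ)) * ((1 + |τ|) ^ 2 / 8) := by
        rw [show ((1 + |τ|) ^ 2 : ℝ) = (1 + |τ|) ^ (2 : ℝ) by norm_cast]
        rw [mul_assoc (8 * C), mul_div_assoc', ← Real.rpow_add hT]
        norm_num
        ring
    _ ≤ 8 * C * (1 + |τ|) ^ (-(3 / 2 : ℝ)) * ‖s‖ ^ 2 := by gcongr

/-! ## `∫_{σ = 2} Q = 0`: move the line to `σ = X → ∞` -/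

/-- Under RH (`0 < ε < 1/2`), the integrals of `Q` on all lines `Re s = X ≥ 2` coincide with the
one on `Re s = 2` (Cauchy; no poles for `Re s > 1`). [folklore] -/
lemma integral_qFun_right_eq (hRH : RiemannHypothesis) {ε : ℝ} (hε : 0 < ε) (hε2 : ε < 1 / 2)
    {X : ℝ} (hX : 2 ≤ X) :
    ∫ t : ℝ, qFun ε ((2 : ℝ) + t * I) = ∫ t : ℝ, qFun ε (X + t * I) := by
  set B₀ : ℝ := ∑' n : ℕ, 1 / ((n : ℝ) + 1) ^ 2 with hB₀
  have hB₀0 : 0 ≤ B₀ := tsum_inv_sq_nonneg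
  refine MertensBoundRH.integral_vertical_eq_of_tendsto (qFun ε) hX ?_
    (integrable_qFun_right hRH hε hε2 le_rfl) (integrable_qFun_right hRH hε hε2 hX) ?_
  · refine (differentiableOn_qFun hRH hε2).mono fun z hz ↦ ⟨?_, ?_⟩
    · show 1 / 2 - ε < z.re
      have : 2 ≤ z.re := hz.1.1; linarith
    · intro h
      have h' : z = 1 := h
      have : 2 ≤ z.re := hz.1.1
      rw [h', one_re] at this; linarith
  · intro δ hδ
    refine ⟨2 * B₀ / δ + 1, fun σ hσ T hT ↦ ?_⟩
    have hpos : 0 ≤ 2 * B₀ / δ := by positivity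
    have hT1 : 1 ≤ |T| := le_trans (by linarith) hT
    have hT0 : 0 < |T| := by linarith
    calc ‖qFun ε (σ + T * I)‖ ≤ 2 * B₀ / ((σ - 1) ^ 2 + T ^ 2) := norm_qFun_right_le hε.le hσ.1 T
      _ ≤ 2 * B₀ / |T| := by
          refine div_le_div_of_nonneg_left (by positivity) hT0 ?_
          have : T ^ 2 = |T| ^ 2 := (sq_abs T).symm
          nlinarith
      _ ≤ δ := by
          rw [div_le_iff₀ hT0]
          have h1 : 2 * B₀ / δ ≤ |T| := by linarith
          rw [div_le_iff₀ hδ] at h1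
          linarith

/-- `∫ dt/(a² + t²) = π/a` and integrability (`a > 0`). [folklore] -/
lemma integral_inv_sq_add_sq {a : ℝ} (ha : 0 < a) :
    Integrable (fun t : ℝ ↦ (a ^ 2 + t ^ 2)⁻¹) ∧ ∫ t : ℝ, (a ^ 2 + t ^ 2)⁻¹ = π / a := by
  have heq : (fun t : ℝ ↦ (a ^ 2 + t ^ 2)⁻¹) = fun t ↦ (a ^ 2)⁻¹ * (1 + (t / a) ^ 2)⁻¹ := by
    funext t
    rw [← mul_inv]
    congr 1
    field_simp
  rw [heq]
  refine ⟨(integrable_inv_one_add_sq.comp_div ha.ne').const_mul _, ?_⟩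
  rw [integral_const_mul, Measure.integral_comp_div (fun u : ℝ ↦ (1 + u ^ 2)⁻¹) a,
    integral_univ_inv_one_add_sq, abs_of_pos ha, smul_eq_mul]
  field_simp

/-- **`∫_{σ=2} Q(s) ds = 0`** (under RH, `0 < ε < 1/2`): the line `σ = 2` may be pushed to
`σ = X → +∞`, where `|Q| ≤ 2B₀/((X−1)² + t²)` integrates to `2πB₀/(X−1) → 0`.
[cite: BalazardDeRoton2010, §4 (proof of Prop. 5, contribution at infinity)] -/
lemma integral_qFun_two_eq_zero (hRH : RiemannHypothesis) {ε : ℝ} (hε : 0 < ε) (hε2 : ε < 1 / 2) :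
    ∫ t : ℝ, qFun ε ((2 : ℝ) + t * I) = 0 := by
  set B₀ : ℝ := ∑' n : ℕ, 1 / ((n : ℝ) + 1) ^ 2 with hB₀
  have hB₀0 : 0 ≤ B₀ := tsum_inv_sq_nonneg
  set v : ℂ := ∫ t : ℝ, qFun ε ((2 : ℝ) + t * I) with hv
  -- `‖v‖ ≤ 2πB₀/(X−1)` for every `X ≥ 2`
  have hbound : ∀ X : ℝ, 2 ≤ X → ‖v‖ ≤ 2 * B₀ * π / (X - 1) := by
    intro X hX
    have hX1 : 0 < X - 1 := by linarith
    obtain ⟨hint, hval⟩ := integral_inv_sq_add_sq hX1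
    rw [hv, integral_qFun_right_eq hRH hε hε2 hX]
    calc ‖∫ t : ℝ, qFun ε (X + t * I)‖ ≤ ∫ t : ℝ, 2 * B₀ * ((X - 1) ^ 2 + t ^ 2)⁻¹ :=
          norm_integral_le_of_norm_le (hint.const_mul _) (ae_of_all _ fun t ↦ by
            rw [← div_eq_mul_inv]; exact norm_qFun_right_le hε.le hX t)
      _ = 2 * B₀ * π / (X - 1) := by rw [integral_const_mul, hval]; ring
  -- let `X → ∞`
  have hlim : Tendsto (fun X : ℝ ↦ 2 * B₀ * π / (X - 1)) atTop (𝓝 0) := by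
    have h := (tendsto_const_nhds (x := 2 * B₀ * π)).div_atTop
      (tendsto_atTop_add_const_right atTop (-1 : ℝ) tendsto_id)
    simpa [sub_eq_add_neg] using h
  have h0 : ‖v‖ ≤ 0 :=
    ge_of_tendsto hlim (eventually_atTop.mpr ⟨2, fun X hX ↦ hbound X hX⟩)
  exact norm_le_zero_iff.mp h0

/-! ## Proposition 5: the exact value of `L_ε` -/

/-- **Balazard–de Roton 2010, Proposition 5 (HR), exact form.** For `0 < ε ≤ 1/4`, under RH,
`∫_ℝ Q(½+iτ) dτ = 2π ((γ−1)·zetaInv(1+ε) + zetaInv'(1+ε))`, i.e.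
`L_ε = (1/2π)∫ ζ(s)/ζ(s+ε) dτ/|s|² = (γ−1)/ζ(1+ε) − ζ'(1+ε)/ζ²(1+ε)`
(residue theorem on the strip `1/2 ≤ σ ≤ 2` around the double pole `s = 1`, plus
`∫_{σ=2} Q = 0`). [cite: BalazardDeRoton2010, Prop. 5] -/
theorem integral_qFun_half (hRH : RiemannHypothesis) {ε : ℝ} (hε : 0 < ε) (hε1 : ε ≤ 1 / 4) :
    ∫ τ : ℝ, qFun ε (((1 / 2 : ℝ) : ℂ) + τ * I) =
      2 * π * ((eulerMascheroniConstant - 1) * zetaInv (1 + ε) + deriv zetaInv (1 + ε)) := by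
  have hε2 : ε < 1 / 2 := by linarith
  obtain ⟨K, hK0, hK⟩ := exists_norm_qFun_strip_le hRH hε
  have hshift := Literature.Analysis.Complex.integral_vertical_sub_eq_sum_of_poles
    (F := qFun ε) (σ₁ := 1 / 2) (κ := 2) (by norm_num) {1} (fun _ ↦ 1) (fun _ ↦ qNum ε)
    {z : ℂ | 1 / 2 - ε < z.re} (isOpen_lt continuous_const Complex.continuous_re)
    (fun z hz ↦ show 1 / 2 - ε < z.re by have := hz.1; linarith)
    (fun p hp ↦ by rw [Finset.mem_singleton] at hp; subst hp; norm_num)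
    (by rw [Finset.coe_singleton]; exact differentiableOn_qFun hRH hε2)
    (fun p hp ↦ by
      rw [Finset.mem_singleton] at hp; subst hp
      refine ⟨{z : ℂ | 1 / 2 - ε < z.re}, (isOpen_lt continuous_const Complex.continuous_re).mem_nhds (by simp; linarith),
        differentiableOn_qNum hRH hε2, fun z _ hz1 ↦ ?_⟩
      rw [qFun_eq_qNum_div hz1])
    (by simpa using integrable_qFun_right hRH hε hε2 (X := 2) le_rfl)
    (integrable_qFun_half hRH hε hε1)
    (Literature.Analysis.Complex.decay_of_bound (g := fun x ↦ K * x ^ (-(1 / 2 : ℝ))) (T₀ := 2)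
      (fun T hT u hu ↦ hK u T hu.1 hu.2 hT)
      (by simpa using (tendsto_rpow_neg_atTop (by norm_num : (0 : ℝ) < 1 / 2)).const_mul K))
  simp only [Finset.sum_singleton, iteratedDeriv_one, Nat.factorial_one, Nat.cast_one, div_one,
    deriv_qNum_one hRH hε] at hshift
  have h2 : ∫ t : ℝ, qFun ε ((2 : ℝ) + t * I) = 0 := integral_qFun_two_eq_zero hRH hε hε2
  rw [h2, zero_sub] at hshift
  linear_combination -hshift

end BalazardDeRoton

end Literature.NumberTheory.LFunctions

end
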